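import Summits.AnomalousDissipation.AnomalousDissipation.Theorems.ImpulseGridGridInjectionIdentity
import Summits.AnomalousDissipation.AnomalousDissipation.Theorems.ImpulseGridAssembly
import Summits.AnomalousDissipation.AnomalousDissipation.Theorems.ImpulseGridGridSignsLawSteadyNecessary

/-!
# Crux `GridSigns` (stmt-AnomalousDissipation-1771), line `SketchIdeator2`: the wake-energy ceilings

Stub `stub_ceilingsYoungBound` of the line's skeleton (`…Theorems.GridSignsCeilings`): for the grid
design `f = Φ•G` with drift `c e₀`, `w = u − c e₀`, a global Leray–Hopf flow with
`sup_{t ≥ 0} ½‖u(t)‖₂² ≤ C` and a generalized limit `Λ`, the four correlation terms of the kick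
formula minus the resonant work are bounded BELOW by localized wake energies. The proof is
pointwise in `(t, x)` (`ceil_pointwise`: Young `|c⟪G,W⟫| ≤ (a/2)|G|² + (c²/2a)|W|²`,
Cauchy–Schwarz `|W₀⟪G,W⟫| ≤ Gmax|W|²`, the strain bound `|⟪W,(W·∇)G⟫| ≤ L|W|²`, `⟪G,u⟫ = ⟪G,W⟫`
as `G₀ ≡ 0`), giving `lower(x,u) ≤ upper(x,u)` for two continuous integrands of quadratic growth
in the velocity value; their slice functionals `t ↦ ∫ F(x, u(t,x)) dx` are bounded on `t > 0` and
interval integrable on every `[0,T]` (Fubini, `ceil_time`), so the inequality integrates over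
`T³`, Cesàro-averages, passes to `Λ` (monotone on eventually bounded Cesàro means, FMRT 2001
Ch. IV (1.35); `ceil_engine`) and splits by linearity (`GridInjection.longTimeAvg_add/sub`).
References: Foias–Manley–Rosa–Temam 2001, Ch. IV §1.3; Doering–Foias 2002, §2.
-/

noncomputable section

-- `Summit.<Summit>.<Problem>` is the mandated summit-side namespace (CONVENTIONS §2); deliberate.
set_option linter.dupNamespace false

open MeasureTheory Set Filter Topology
open scoped InnerProductSpace RealInnerProductSpace

namespace Summit.AnomalousDissipation.AnomalousDissipation.Theorems.GridSignsCeilings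

open Literature.Analysis
open Literature.Analysis.FluidPDE Literature.Analysis.FluidPDE.Torus
open Literature.Analysis.FunctionSpaces Literature.Analysis.FunctionSpaces.Torus
open Summit.AnomalousDissipation.AnomalousDissipation.Theses.ImpulseGrid

section QuadGrowth

variable {F F' : UnitAddTorus (Fin 3) → EuclideanSpace ℝ (Fin 3) → ℝ} {θ : UnitAddTorus (Fin 3) → ℝ}
  {G : UnitAddTorus (Fin 3) → EuclideanSpace ℝ (Fin 3)}

/-- Sum of two continuous integrands of quadratic growth. [folklore] -/
theorem qg_add
    (hF : Continuous (Function.uncurry F) ∧ ∃ K : ℝ, ∀ x v, |F x v| ≤ K * (1 + ‖v‖ ^ 2))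
    (hF' : Continuous (Function.uncurry F') ∧ ∃ K : ℝ, ∀ x v, |F' x v| ≤ K * (1 + ‖v‖ ^ 2)) :
    Continuous (Function.uncurry fun x v => F x v + F' x v) ∧
      ∃ K : ℝ, ∀ x v, |F x v + F' x v| ≤ K * (1 + ‖v‖ ^ 2) := by
  obtain ⟨hc, K, hK⟩ := hF
  obtain ⟨hc', K', hK'⟩ := hF'
  refine ⟨hc.add hc', K + K', fun x v => (abs_add_le _ _).trans ?_⟩
  rw [add_mul]
  exact add_le_add (hK x v) (hK' x v)

/-- Difference of two continuous integrands of quadratic growth. [folklore] -/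
theorem qg_sub
    (hF : Continuous (Function.uncurry F) ∧ ∃ K : ℝ, ∀ x v, |F x v| ≤ K * (1 + ‖v‖ ^ 2))
    (hF' : Continuous (Function.uncurry F') ∧ ∃ K : ℝ, ∀ x v, |F' x v| ≤ K * (1 + ‖v‖ ^ 2)) :
    Continuous (Function.uncurry fun x v => F x v - F' x v) ∧
      ∃ K : ℝ, ∀ x v, |F x v - F' x v| ≤ K * (1 + ‖v‖ ^ 2) := by
  obtain ⟨hc, K, hK⟩ := hF
  obtain ⟨hc', K', hK'⟩ := hF'
  refine ⟨hc.sub hc', K + K', fun x v => (abs_sub _ _).trans ?_⟩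
  rw [add_mul]
  exact add_le_add (hK x v) (hK' x v)

/-- A continuous integrand of quadratic growth times a continuous weight on the compact torus.
[folklore] -/
theorem qg_weight (hθ : Continuous θ)
    (hF : Continuous (Function.uncurry F) ∧ ∃ K : ℝ, ∀ x v, |F x v| ≤ K * (1 + ‖v‖ ^ 2)) :
    Continuous (Function.uncurry fun x v => θ x * F x v) ∧
      ∃ K : ℝ, ∀ x v, |θ x * F x v| ≤ K * (1 + ‖v‖ ^ 2) := by
  obtain ⟨hc, K, hK⟩ := hF
  obtain ⟨M, hM0, hM⟩ := FluidPDE.Torus.exists_nonneg_forall_norm_le_of_continuous hθ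
  refine ⟨(hθ.comp continuous_fst).mul hc, M * K, fun x v => ?_⟩
  rw [abs_mul, mul_assoc]
  have hθx : |θ x| ≤ M := by rw [← Real.norm_eq_abs]; exact hM x
  exact mul_le_mul hθx (hK x v) (abs_nonneg _) hM0

/-- A constant multiple of a continuous integrand of quadratic growth. [folklore] -/
theorem qg_const_mul (k : ℝ)
    (hF : Continuous (Function.uncurry F) ∧ ∃ K : ℝ, ∀ x v, |F x v| ≤ K * (1 + ‖v‖ ^ 2)) :
    Continuous (Function.uncurry fun x v => k * F x v) ∧
      ∃ K : ℝ, ∀ x v, |k * F x v| ≤ K * (1 + ‖v‖ ^ 2) :=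
  qg_weight continuous_const hF

/-- The (velocity independent) design energy density `χ|G|² + |G|²` has quadratic growth.
[folklore] -/
theorem qg_design (hθ : Continuous θ) (hG : Continuous G) :
    Continuous (Function.uncurry fun (x : UnitAddTorus (Fin 3)) (_ : EuclideanSpace ℝ (Fin 3)) =>
        θ x * ‖G x‖ ^ 2 + ‖G x‖ ^ 2) ∧
      ∃ K : ℝ, ∀ x (v : EuclideanSpace ℝ (Fin 3)),
        |θ x * ‖G x‖ ^ 2 + ‖G x‖ ^ 2| ≤ K * (1 + ‖v‖ ^ 2) := by
  have hc : Continuous fun x => θ x * ‖G x‖ ^ 2 + ‖G x‖ ^ 2 := by fun_prop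
  obtain ⟨M, hM0, hM⟩ := FluidPDE.Torus.exists_nonneg_forall_norm_le_of_continuous hc
  refine ⟨hc.comp continuous_fst, M, fun x v => ?_⟩
  have hx : |θ x * ‖G x‖ ^ 2 + ‖G x‖ ^ 2| ≤ M := by rw [← Real.norm_eq_abs]; exact hM x
  nlinarith [sq_nonneg ‖v‖]

/-- `‖v - e‖² ≤ (2 + 2‖e‖²)(1 + ‖v‖²)`. [folklore] -/
theorem norm_sub_sq_le_quad (v e : EuclideanSpace ℝ (Fin 3)) :
    ‖v - e‖ ^ 2 ≤ (2 + 2 * ‖e‖ ^ 2) * (1 + ‖v‖ ^ 2) := by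
  have h1 : ‖v - e‖ ≤ ‖v‖ + ‖e‖ := norm_sub_le v e
  have h2 : ‖v - e‖ ^ 2 ≤ (‖v‖ + ‖e‖) ^ 2 := pow_le_pow_left₀ (norm_nonneg _) h1 2
  nlinarith [sq_nonneg (‖v‖ - ‖e‖), mul_nonneg (sq_nonneg ‖e‖) (sq_nonneg ‖v‖)]

/-- The shifted energy density `‖v - e‖²` has quadratic growth. [folklore] -/
theorem qg_norm_sub_sq (e : EuclideanSpace ℝ (Fin 3)) :
    Continuous (Function.uncurry fun (_ : UnitAddTorus (Fin 3)) v => ‖v - e‖ ^ 2) ∧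
      ∃ K : ℝ, ∀ (_ : UnitAddTorus (Fin 3)) v, |‖v - e‖ ^ 2| ≤ K * (1 + ‖v‖ ^ 2) := by
  refine ⟨(continuous_snd.sub continuous_const).norm.pow 2, 2 + 2 * ‖e‖ ^ 2, fun x v => ?_⟩
  rw [abs_of_nonneg (sq_nonneg _)]
  exact norm_sub_sq_le_quad v e

/-- The pairing `⟪G x, v⟫` with a continuous field has quadratic growth. [folklore] -/
theorem qg_inner (hG : Continuous G) :
    Continuous (Function.uncurry fun x (v : EuclideanSpace ℝ (Fin 3)) => ⟪G x, v⟫) ∧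
      ∃ K : ℝ, ∀ x (v : EuclideanSpace ℝ (Fin 3)), |⟪G x, v⟫| ≤ K * (1 + ‖v‖ ^ 2) := by
  obtain ⟨M, hM0, hM⟩ := FluidPDE.Torus.exists_nonneg_forall_norm_le_of_continuous hG
  refine ⟨(hG.comp continuous_fst).inner continuous_snd, M, fun x v => ?_⟩
  calc |⟪G x, v⟫| ≤ ‖G x‖ * ‖v‖ := abs_real_inner_le_norm _ _
    _ ≤ M * ‖v‖ := mul_le_mul_of_nonneg_right (hM x) (norm_nonneg _)
    _ ≤ M * (1 + ‖v‖ ^ 2) :=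
        mul_le_mul_of_nonneg_left (by nlinarith [sq_nonneg (‖v‖ - 1)]) hM0

/-- The cross moment `(v - e)₀ ⟪G x, v⟫` with a continuous field has quadratic growth. [folklore] -/
theorem qg_coord_mul_inner (hG : Continuous G) (e : EuclideanSpace ℝ (Fin 3)) :
    Continuous (Function.uncurry fun x v => (v - e) 0 * ⟪G x, v⟫) ∧
      ∃ K : ℝ, ∀ x v, |(v - e) 0 * ⟪G x, v⟫| ≤ K * (1 + ‖v‖ ^ 2) := by
  obtain ⟨M, hM0, hM⟩ := FluidPDE.Torus.exists_nonneg_forall_norm_le_of_continuous hG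
  refine ⟨?_, M * (1 + ‖e‖), fun x v => ?_⟩
  · show Continuous fun p : UnitAddTorus (Fin 3) × EuclideanSpace ℝ (Fin 3) =>
      (p.2 - e) 0 * ⟪G p.1, p.2⟫
    fun_prop
  · have h0 : |(v - e) 0| ≤ ‖v‖ + ‖e‖ :=
      (Real.norm_eq_abs _ ▸ PiLp.norm_apply_le (v - e) 0).trans (norm_sub_le v e)
    have h1 : |⟪G x, v⟫| ≤ M * ‖v‖ :=
      (abs_real_inner_le_norm _ _).trans (mul_le_mul_of_nonneg_right (hM x) (norm_nonneg _))
    have h2 : |(v - e) 0| * |⟪G x, v⟫| ≤ (‖v‖ + ‖e‖) * (M * ‖v‖) :=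
      mul_le_mul h0 h1 (abs_nonneg _) (by positivity)
    have h3 : 0 ≤ 1 + ‖v‖ ^ 2 - ‖v‖ := by nlinarith [sq_nonneg (‖v‖ - 1)]
    rw [abs_mul]
    nlinarith [mul_nonneg (mul_nonneg hM0 (norm_nonneg e)) h3]

/-- The strain pairing `⟪v - e, (DG)(x)(v - e)⟫` with a smooth field has quadratic growth
(`|⟪U,(U·∇)G⟫| ≤ C|U|²`, `abs_inner_convect_self_le`). [folklore] -/
theorem qg_inner_fderiv (hG : IsSmooth G) (e : EuclideanSpace ℝ (Fin 3)) :
    Continuous (Function.uncurry fun x v => ⟪v - e, Torus.fderiv G x (v - e)⟫) ∧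
      ∃ K : ℝ, ∀ x v, |⟪v - e, Torus.fderiv G x (v - e)⟫| ≤ K * (1 + ‖v‖ ^ 2) := by
  obtain ⟨C, hC0, hC⟩ := exists_sum_norm_partialDeriv_le hG
  have h1 : IsContDiff 1 G := hG.isContDiff (by simp)
  refine ⟨?_, C * (2 + 2 * ‖e‖ ^ 2), fun x v => ?_⟩
  · have heq : (Function.uncurry fun x v => ⟪v - e, Torus.fderiv G x (v - e)⟫) =
        fun p => ⟪p.2 - e, ∑ i, (p.2 - e) i • Torus.partialDeriv i G p.1⟫ := by
      funext p
      simp only [Function.uncurry, fderiv_apply_eq_sum_partialDeriv h1]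
    have hpd : ∀ i, Continuous (Torus.partialDeriv i G) := fun i => (hG.partialDeriv i).continuous
    rw [heq]
    fun_prop
  · have h := abs_inner_convect_self_le (U := fun _ => v - e) h1 hC x
    refine h.trans ?_
    rw [mul_assoc]
    exact mul_le_mul_of_nonneg_left (norm_sub_sq_le_quad v e) hC0

/-- On an `L²` slice `U`, a continuous integrand of quadratic growth gives an integrable
`x ↦ F(x, U x)` with `|∫ F(x, U x) dx| ≤ K (1 + 2 E(U))` (the torus has volume one). [folklore] -/
theorem ceil_slice (hFc : Continuous (Function.uncurry F)) {K : ℝ}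
    (hK : ∀ x v, |F x v| ≤ K * (1 + ‖v‖ ^ 2)) {U : UnitAddTorus (Fin 3) → EuclideanSpace ℝ (Fin 3)}
    (hU : MemLp U 2 volume) :
    Integrable (fun x => F x (U x)) volume ∧ |∫ x, F x (U x)| ≤ K * (1 + 2 * kineticEnergy U) := by
  have i2 : Integrable (fun x => ‖U x‖ ^ 2) volume := hU.integrable_norm_pow two_ne_zero
  have ib : Integrable (fun x => K * (1 + ‖U x‖ ^ 2)) volume :=
    ((integrable_const (1 : ℝ)).add i2).const_mul K
  have hmeas : AEStronglyMeasurable (fun x => F x (U x)) volume :=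
    hFc.comp_aestronglyMeasurable (aestronglyMeasurable_id.prodMk hU.1)
  have hint : Integrable (fun x => F x (U x)) volume :=
    ib.mono' hmeas (ae_of_all _ fun x => by rw [Real.norm_eq_abs]; exact hK x (U x))
  refine ⟨hint, ?_⟩
  have h1 : |∫ x, F x (U x)| ≤ ∫ x, K * (1 + ‖U x‖ ^ 2) :=
    abs_integral_le_integral_abs.trans (integral_mono_of_nonneg
      (ae_of_all _ fun x => abs_nonneg _) ib (ae_of_all _ fun x => hK x (U x)))
  have h1' : ∫ _ : UnitAddTorus (Fin 3), (1 : ℝ) = 1 := by simp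
  have h2 : ∫ x, K * (1 + ‖U x‖ ^ 2) = K * (1 + 2 * kineticEnergy U) := by
    rw [integral_const_mul, integral_add (integrable_const _) i2, h1', kineticEnergy]
    ring
  exact h1.trans_eq h2

variable {ν C : ℝ} {f u : ℝ → UnitAddTorus (Fin 3) → EuclideanSpace ℝ (Fin 3)}
  {u₀ : UnitAddTorus (Fin 3) → EuclideanSpace ℝ (Fin 3)}

/-- Along a global Leray–Hopf solution whose kinetic energy is bounded on `t ≥ 0`, the slice
functional `t ↦ ∫ F(x, u(t,x)) dx` of a continuous integrand of quadratic growth is integrable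
in `x` for `t ≥ 0`, bounded on `t > 0`, and interval integrable on every `[0, T]` (measurable by
Fubini from the joint measurability of `u` on `(0,T) × T³`). [folklore] -/
theorem ceil_time (hu : IsGlobalLerayHopf ν f u₀ u)
    (hF : Continuous (Function.uncurry F) ∧ ∃ K : ℝ, ∀ x v, |F x v| ≤ K * (1 + ‖v‖ ^ 2))
    (hC : ∀ t : ℝ, 0 ≤ t → kineticEnergy (u t) ≤ C) :
    (∀ t : ℝ, 0 ≤ t → Integrable (fun x => F x (u t x)) volume) ∧
      (∃ B : ℝ, ∀ t : ℝ, 0 < t → |∫ x, F x (u t x)| ≤ B) ∧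
      ∀ T : ℝ, 0 < T → IntervalIntegrable (fun t => ∫ x, F x (u t x)) volume 0 T := by
  obtain ⟨hFc, K, hK⟩ := hF
  have hK0 : 0 ≤ K := by
    have h := hK 0 0
    rw [norm_zero, zero_pow two_ne_zero, add_zero, mul_one] at h
    exact (abs_nonneg _).trans h
  have hb : ∀ t : ℝ, 0 ≤ t → |∫ x, F x (u t x)| ≤ K * (1 + 2 * C) := fun t ht =>
    (ceil_slice hFc hK (hu.memLp_two ht)).2.trans
      (mul_le_mul_of_nonneg_left (by linarith [hC t ht]) hK0)
  refine ⟨fun t ht => (ceil_slice hFc hK (hu.memLp_two ht)).1,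
    ⟨K * (1 + 2 * C), fun t ht => hb t ht.le⟩, fun T hT => ?_⟩
  rw [intervalIntegrable_iff_integrableOn_Ioo_of_le hT.le]
  have hmeas : AEStronglyMeasurable (fun t => ∫ x, F x (u t x)) (volume.restrict (Ioo 0 T)) := by
    have h1 : AEStronglyMeasurable
        (fun p : ℝ × UnitAddTorus (Fin 3) => F p.2 (Function.uncurry u p))
        ((volume.restrict (Ioo 0 T)).prod volume) :=
      hFc.comp_aestronglyMeasurable
        (continuous_snd.aestronglyMeasurable.prodMk (hu T hT).aestronglyMeasurable_uncurry)
    exact h1.integral_prod_right'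
  refine ⟨hmeas, HasFiniteIntegral.of_bounded (C := K * (1 + 2 * C)) ?_⟩
  filter_upwards [ae_restrict_mem measurableSet_Ioo] with t ht
  rw [Real.norm_eq_abs]
  exact hb t ht.1.le

/-- **Monotonicity under the generalized limit.** For two continuous integrands of quadratic
growth with `F ≤ F'` pointwise, `Λ⟨∫F(x,u)⟩ ≤ Λ⟨∫F'(x,u)⟩`: the slice integrals are ordered for
`t ≥ 0`, hence so are the Cesàro means (`T > 0`), which are eventually bounded, and `Λ` is
monotone there (FMRT 2001, Ch. IV (1.35)). [folklore] -/
theorem ceil_engine (Λ : GeneralizedLimit) (hu : IsGlobalLerayHopf ν f u₀ u)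
    (hC : ∀ t : ℝ, 0 ≤ t → kineticEnergy (u t) ≤ C)
    (hF : Continuous (Function.uncurry F) ∧ ∃ K : ℝ, ∀ x v, |F x v| ≤ K * (1 + ‖v‖ ^ 2))
    (hF' : Continuous (Function.uncurry F') ∧ ∃ K : ℝ, ∀ x v, |F' x v| ≤ K * (1 + ‖v‖ ^ 2))
    (hle : ∀ x v, F x v ≤ F' x v) :
    Λ.longTimeAvg (fun t => ∫ x, F x (u t x)) ≤ Λ.longTimeAvg (fun t => ∫ x, F' x (u t x)) := by
  obtain ⟨hi, ⟨B, hB⟩, hI⟩ := ceil_time hu hF hC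
  obtain ⟨hi', ⟨B', hB'⟩, hI'⟩ := ceil_time hu hF' hC
  refine Λ.apply_mono (isBoundedUnder_ge_timeMean hB) (isBoundedUnder_le_timeMean hB')
    ((eventually_gt_atTop 0).mono fun T hT => ?_)
  refine mul_le_mul_of_nonneg_left (intervalIntegral.integral_mono_on hT.le (hI T hT) (hI' T hT)
    fun t ht => ?_) (inv_nonneg.2 hT.le)
  exact integral_mono_ae (hi t ht.1) (hi' t ht.1) (ae_of_all _ fun x => hle x (u t x))

/-- `Λ⟨∫(F + F')(x,u)⟩ = Λ⟨∫F(x,u)⟩ + Λ⟨∫F'(x,u)⟩` for continuous integrands of quadratic growth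
(linearity of the integral on `L²` slices and of `Λ ∘ timeMean` on interval-integrable functions).
[folklore] -/
theorem ceil_lta_add (Λ : GeneralizedLimit) (hu : IsGlobalLerayHopf ν f u₀ u)
    (hC : ∀ t : ℝ, 0 ≤ t → kineticEnergy (u t) ≤ C)
    (hF : Continuous (Function.uncurry F) ∧ ∃ K : ℝ, ∀ x v, |F x v| ≤ K * (1 + ‖v‖ ^ 2))
    (hF' : Continuous (Function.uncurry F') ∧ ∃ K : ℝ, ∀ x v, |F' x v| ≤ K * (1 + ‖v‖ ^ 2)) :
    Λ.longTimeAvg (fun t => ∫ x, (F x (u t x) + F' x (u t x))) =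
      Λ.longTimeAvg (fun t => ∫ x, F x (u t x)) + Λ.longTimeAvg (fun t => ∫ x, F' x (u t x)) := by
  obtain ⟨hi, -, hI⟩ := ceil_time hu hF hC
  obtain ⟨hi', -, hI'⟩ := ceil_time hu hF' hC
  rw [← GridInjection.longTimeAvg_add Λ hI hI']
  exact Λ.longTimeAvg_congr fun t ht => integral_add (hi t ht.le) (hi' t ht.le)

/-- `Λ⟨∫(F − F')(x,u)⟩ = Λ⟨∫F(x,u)⟩ − Λ⟨∫F'(x,u)⟩` for continuous integrands of quadratic
growth. [folklore] -/
theorem ceil_lta_sub (Λ : GeneralizedLimit) (hu : IsGlobalLerayHopf ν f u₀ u)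
    (hC : ∀ t : ℝ, 0 ≤ t → kineticEnergy (u t) ≤ C)
    (hF : Continuous (Function.uncurry F) ∧ ∃ K : ℝ, ∀ x v, |F x v| ≤ K * (1 + ‖v‖ ^ 2))
    (hF' : Continuous (Function.uncurry F') ∧ ∃ K : ℝ, ∀ x v, |F' x v| ≤ K * (1 + ‖v‖ ^ 2)) :
    Λ.longTimeAvg (fun t => ∫ x, (F x (u t x) - F' x (u t x))) =
      Λ.longTimeAvg (fun t => ∫ x, F x (u t x)) - Λ.longTimeAvg (fun t => ∫ x, F' x (u t x)) := by
  obtain ⟨hi, -, hI⟩ := ceil_time hu hF hC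
  obtain ⟨hi', -, hI'⟩ := ceil_time hu hF' hC
  rw [← GridInjection.longTimeAvg_sub Λ hI hI']
  exact Λ.longTimeAvg_congr fun t ht => integral_sub (hi t ht.le) (hi' t ht.le)

end QuadGrowth

/-- **Pointwise ceilings.** For `V ∈ ℝ³`, `W = V − c e₀`: Young
`|c⟪G,W⟫| ≤ (a/2)|G|² + (c²/2a)|W|²`, Cauchy–Schwarz `|W₀⟪G,W⟫| ≤ Gmax|W|²`, the strain bound
`|⟪W,DG(x)W⟫| ≤ L|W|²` and `⟪G,V⟫ = ⟪G,W⟫` (`G₀ ≡ 0`), weighted by `χ, Φ, H ≥ 0`, give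
`lower(x,V) ≤ upper(x,V)`. [folklore] -/
theorem ceil_pointwise {c a Gmax L : ℝ} {Φ χ H : UnitAddTorus (Fin 3) → ℝ}
    {G : UnitAddTorus (Fin 3) → EuclideanSpace ℝ (Fin 3)} (hG0 : ∀ x, G x 0 = 0)
    (hΦnn : ∀ x, 0 ≤ Φ x) (hχnn : ∀ x, 0 ≤ χ x) (hHnn : ∀ x, 0 ≤ H x) (hGmax : ∀ x, ‖G x‖ ≤ Gmax)
    (hL : ∀ x (v : EuclideanSpace ℝ (Fin 3)), |⟪v, Torus.fderiv G x v⟫| ≤ L * ‖v‖ ^ 2)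
    (ha : 0 < a) (hc : 0 ≤ c) (x : UnitAddTorus (Fin 3)) (V : EuclideanSpace ℝ (Fin 3)) :
    -(a / 2) * (χ x * ‖G x‖ ^ 2 + ‖G x‖ ^ 2)
        - c ^ 2 / (2 * a) * (χ x * ‖V - c • EuclideanSpace.single 0 1‖ ^ 2
            + ‖V - c • EuclideanSpace.single 0 1‖ ^ 2)
        - Gmax * (χ x * ‖V - c • EuclideanSpace.single 0 1‖ ^ 2
            + Φ x * ‖V - c • EuclideanSpace.single 0 1‖ ^ 2)
        - L * (H x * ‖V - c • EuclideanSpace.single 0 1‖ ^ 2)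
      ≤ c * (χ x * ⟪G x, V⟫)
        + χ x * ((V - c • EuclideanSpace.single 0 1 : EuclideanSpace ℝ (Fin 3)) 0 * ⟪G x, V⟫)
        - Φ x * ((V - c • EuclideanSpace.single 0 1 : EuclideanSpace ℝ (Fin 3)) 0 * ⟪G x, V⟫)
        + H x * ⟪V - c • EuclideanSpace.single 0 1,
            Torus.fderiv G x (V - c • EuclideanSpace.single 0 1)⟫
        - c * ⟪G x, V⟫ := by
  set W : EuclideanSpace ℝ (Fin 3) := V - c • EuclideanSpace.single 0 1 with hW
  have hGV : ⟪G x, V⟫ = ⟪G x, W⟫ := by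
    simp [hW, inner_sub_right, real_inner_smul_right, EuclideanSpace.inner_single_right, hG0 x]
  rw [hGV]
  have hGW : |⟪G x, W⟫| ≤ Gmax * ‖W‖ :=
    (abs_real_inner_le_norm _ _).trans (mul_le_mul_of_nonneg_right (hGmax x) (norm_nonneg _))
  have hW0 : |W 0| ≤ ‖W‖ := Real.norm_eq_abs _ ▸ PiLp.norm_apply_le W 0
  have hyoung : c * (‖G x‖ * ‖W‖) ≤ a / 2 * ‖G x‖ ^ 2 + c ^ 2 / (2 * a) * ‖W‖ ^ 2 := by
    have h : a / 2 * ‖G x‖ ^ 2 + c ^ 2 / (2 * a) * ‖W‖ ^ 2 - c * (‖G x‖ * ‖W‖) =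
        (a * ‖G x‖ - c * ‖W‖) ^ 2 / (2 * a) := by
      field_simp
      ring
    have h2 : 0 ≤ (a * ‖G x‖ - c * ‖W‖) ^ 2 / (2 * a) := by positivity
    linarith
  have e1 := abs_le.1 (show |c * ⟪G x, W⟫| ≤ a / 2 * ‖G x‖ ^ 2 + c ^ 2 / (2 * a) * ‖W‖ ^ 2 by
    rw [abs_mul, abs_of_nonneg hc]
    exact (mul_le_mul_of_nonneg_left (abs_real_inner_le_norm _ _) hc).trans hyoung)
  have e2 := abs_le.1 (show |W 0 * ⟪G x, W⟫| ≤ Gmax * ‖W‖ ^ 2 by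
    rw [abs_mul]
    calc |W 0| * |⟪G x, W⟫| ≤ ‖W‖ * (Gmax * ‖W‖) :=
          mul_le_mul hW0 hGW (abs_nonneg _) (norm_nonneg _)
      _ = Gmax * ‖W‖ ^ 2 := by ring)
  have e4 := abs_le.1 (hL x W)
  have f1 := mul_le_mul_of_nonneg_left e1.1 (hχnn x)
  have f2 := mul_le_mul_of_nonneg_left e2.1 (hχnn x)
  have f3 := mul_le_mul_of_nonneg_left e2.2 (hΦnn x)
  have f4 := mul_le_mul_of_nonneg_left e4.1 (hHnn x)
  linarith [f1, f2, f3, f4, e1.2]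

/-- **Stub S3 (ceilings: Young and strain bounds under the generalized limit).** The four
correlation terms of the kick formula minus the resonant work are bounded BELOW by localized
wake-energy ceilings: pointwise in `(t, x)`, `c·χ⟪G,w⟫ ≥ −χ(a|G|²/2 + c²|w|²/(2a))`,
`|w₀⟪G,w⟫| ≤ Gmax |w|²`, `H⟪w,(w·∇)G⟫ ≥ −H·L|w|²`, `c⟪G,w⟫ ≤ a|G|²/2 + c²|w|²/(2a)` (Young;
`⟪G,u⟫ = ⟪G,w⟫` since `G₀ = 0`), integrated over `T³`, Cesàro-averaged and passed to `Λ`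
(monotone and linear on the eventually bounded Cesàro means of a sup-bounded Leray–Hopf flow).
Sqrt-free form of the card's KickInjectionFloor plus the bulk Cauchy–Schwarz. [folklore] -/
theorem stub_ceilingsYoungBound :
    ∀ (Λ : GeneralizedLimit) (ν c a Gmax L : ℝ) (Φ χ H : UnitAddTorus (Fin 3) → ℝ)
      (G : UnitAddTorus (Fin 3) → EuclideanSpace ℝ (Fin 3))
      (u₀ : UnitAddTorus (Fin 3) → EuclideanSpace ℝ (Fin 3))
      (u : ℝ → UnitAddTorus (Fin 3) → EuclideanSpace ℝ (Fin 3)),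
      0 < ν → IsSmooth Φ → IsSmooth χ → IsSmooth H → IsSmooth G → (∀ x, G x 0 = 0) →
      (∀ x, 0 ≤ Φ x) → (∀ x, 0 ≤ χ x) → (∀ x, 0 ≤ H x) → (∀ x, ‖G x‖ ≤ Gmax) →
      (∀ x (v : EuclideanSpace ℝ (Fin 3)), |⟪v, Torus.convect (fun _ => v) G x⟫| ≤ L * ‖v‖ ^ 2) →
      0 < a → 0 ≤ c →
      IsGlobalLerayHopf ν (fun _ => fun x => Φ x • G x) u₀ u →
      (∃ C : ℝ, ∀ t : ℝ, 0 ≤ t → kineticEnergy (u t) ≤ C) →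
      -(a / 2) * ((∫ x, χ x * ‖G x‖ ^ 2) + ∫ x, ‖G x‖ ^ 2)
          - (c ^ 2 / (2 * a)) *
              (Λ.longTimeAvg (fun t => ∫ x, χ x * ‖u t x - c • EuclideanSpace.single 0 1‖ ^ 2)
                + Λ.longTimeAvg (fun t => ∫ x, ‖u t x - c • EuclideanSpace.single 0 1‖ ^ 2))
          - Gmax * (Λ.longTimeAvg (fun t => ∫ x, χ x * ‖u t x - c • EuclideanSpace.single 0 1‖ ^ 2)
                + Λ.longTimeAvg (fun t => ∫ x, Φ x * ‖u t x - c • EuclideanSpace.single 0 1‖ ^ 2))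
          - L * Λ.longTimeAvg (fun t => ∫ x, H x * ‖u t x - c • EuclideanSpace.single 0 1‖ ^ 2)
        ≤ c * Λ.longTimeAvg (fun t => ∫ x, χ x * ⟪G x, u t x⟫)
          + Λ.longTimeAvg (fun t => ∫ x, χ x * ((u t x - c • EuclideanSpace.single 0 1 : EuclideanSpace ℝ (Fin 3)) 0 * ⟪G x, u t x⟫))
          - Λ.longTimeAvg (fun t => ∫ x, Φ x * ((u t x - c • EuclideanSpace.single 0 1 : EuclideanSpace ℝ (Fin 3)) 0 * ⟪G x, u t x⟫))
          + Λ.longTimeAvg (fun t => ∫ x, H x * ⟪u t x - c • EuclideanSpace.single 0 1,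
              Torus.convect (fun y => u t y - c • EuclideanSpace.single 0 1) G x⟫)
          - c * Λ.longTimeAvg (fun t => ∫ x, ⟪G x, u t x⟫) := by
  intro Λ ν c a Gmax L Φ χ H G u₀ u hν hΦ hχ hH hG hG0 hΦnn hχnn hHnn hGmax hL ha hc hu hE
  obtain ⟨C, hC⟩ := hE
  simp only [Torus.convect] at hL ⊢
  obtain ⟨hΦc, hχc, hHc, hGc⟩ :
    Continuous Φ ∧ Continuous χ ∧ Continuous H ∧ Continuous G :=
    ⟨hΦ.continuous, hχ.continuous, hH.continuous, hG.continuous⟩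
  -- the elementary integrands of quadratic growth and the weighted pieces
  have q0 := qg_design hχc hGc
  have q1 := qg_norm_sub_sq (c • EuclideanSpace.single 0 1)
  have q2 := qg_inner hGc
  have q3 := qg_coord_mul_inner hGc (c • EuclideanSpace.single 0 1)
  have q4 := qg_inner_fderiv hG (c • EuclideanSpace.single 0 1)
  have lB := qg_const_mul (c ^ 2 / (2 * a)) (qg_add (qg_weight hχc q1) q1)
  have lC := qg_const_mul Gmax (qg_add (qg_weight hχc q1) (qg_weight hΦc q1))
  have lD := qg_const_mul L (qg_weight hHc q1)
  have lA := qg_const_mul (-(a / 2)) q0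
  have u5 := qg_const_mul c (qg_weight hχc q2)
  have u6 := qg_weight hχc q3
  have u7 := qg_weight hΦc q3
  have u8 := qg_weight hHc q4
  have u9 := qg_const_mul c q2
  -- Λ-monotonicity on the single pointwise inequality, then linearity
  have hmono := ceil_engine Λ hu hC (qg_sub (qg_sub (qg_sub lA lB) lC) lD)
    (qg_sub (qg_add (qg_sub (qg_add u5 u6) u7) u8) u9)
    (fun x V => ceil_pointwise hG0 hΦnn hχnn hHnn hGmax hL ha hc x V)
  rw [ceil_lta_sub Λ hu hC (qg_sub (qg_sub lA lB) lC) lD, ceil_lta_sub Λ hu hC (qg_sub lA lB) lC,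
    ceil_lta_sub Λ hu hC lA lB, ceil_lta_sub Λ hu hC (qg_add (qg_sub (qg_add u5 u6) u7) u8) u9,
    ceil_lta_add Λ hu hC (qg_sub (qg_add u5 u6) u7) u8, ceil_lta_sub Λ hu hC (qg_add u5 u6) u7,
    ceil_lta_add Λ hu hC u5 u6] at hmono
  simp only [integral_const_mul, GridInjection.longTimeAvg_const_mul] at hmono
  have iχG : Integrable (fun x => χ x * ‖G x‖ ^ 2) volume :=
    (by fun_prop : Continuous fun x => χ x * ‖G x‖ ^ 2).integrable_unitAddTorus
  have iG : Integrable (fun x => ‖G x‖ ^ 2) volume :=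
    (by fun_prop : Continuous fun x => ‖G x‖ ^ 2).integrable_unitAddTorus
  rw [ceil_lta_add Λ hu hC (qg_weight hχc q1) q1, ceil_lta_add Λ hu hC (qg_weight hχc q1)
    (qg_weight hΦc q1), steady_longTimeAvg_const, integral_add iχG iG] at hmono
  exact hmono

end Summit.AnomalousDissipation.AnomalousDissipation.Theorems.GridSignsCeilings

end
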